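import Summits.QuantumAdvantage.QuantumAdvantage.Theses.SosSandwich
import Summits.QuantumAdvantage.QuantumAdvantage.Theorems.SosSandwichPseudoBoundedAALevelDescentOfPBAA
import Summits.QuantumAdvantage.QuantumAdvantage.Theorems.SosSandwichHomogeneousPBAATExponent
import Summits.QuantumAdvantage.QuantumAdvantage.Theorems.SosSandwichOneQueryFrameAA
import Summits.QuantumAdvantage.QuantumAdvantage.Theorems.SosSandwichPseudoBoundedClosure
import Literature.Computability.QuantumComplexity.PseudoBounded
import HarnessLib

/-!
# Route `SosSandwich`, crux `PseudoBoundedAA` (stmt-QuantumAdvantage-15237) — the REPAIRED two-layer line, certified: `PB-AA ⟺ HomogeneousPBAAT ∧ LevelDescent`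

The registered birth skeleton of the crux (`Cruxes/PseudoBoundedAA/Lines/birth.lean`, sha 981f5797…) composes
`PseudoBoundedAA` from `stub_homogeneousRung : HomogeneousPBAA` (the DEGREE-FREE homogeneous rung — REFUTED,
`Theorems.SosSandwich.not_HomogeneousPBAA`, p823896: composed address functions, `Var = 1/4`, every influence
`1/T`) and `stub_levelDescent` (level descent with polynomial loss to the flat base classes `T' = 1` /
top-homogeneous, influences dominated).  The route was repaired (rev 2) by restating the rung T-LOSSILY as the
support item `HomogeneousPBAAT` (stmt-QuantumAdvantage-27399: `maxInf ≥ C·(Var/T)^c` on the top-homogeneous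
class), but the skeleton itself still names the dead stub; re-registering it is a lead/planner verb.  This file
LANDS THE REPAIRED COMPOSITION as a theorem, so that the re-registration is mechanical and the census has the
exact shape of the line in the kernel:

* `pseudoBoundedAA_of_homogeneousPBAAT_of_levelDescent` — **`HomogeneousPBAAT → LevelDescent → PseudoBoundedAA`**
  (the repaired `PseudoBoundedAA_of`; real arithmetic: pull an influential variable of the surrogate back
  through the domination clause; in the top-homogeneous case the `1/T'` loss of the repaired rung is absorbed by
  `T' ≤ T` and `ε ≤ Var ≤ 1/4 ≤ 1`, giving exponent `2a + (a+1)c` and constant `min(4A²/9, C·A^c)/B`);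
* `homogeneousPBAAT_of_pseudoBoundedAA` — the crux gives the repaired rung with the same constants
  (wrapper of `homogeneousPBAAT_body_of_pseudoBoundedAA_body`, lineage leafhand-3 g2);
* `pseudoBoundedAA_iff_homogeneousPBAAT_and_levelDescent` — **`PseudoBoundedAA ↔ HomogeneousPBAAT ∧ LevelDescent`**
  (with `levelDescent_of_pseudoBoundedAA`, lineage leafhand-1 g2): the repaired two-layer plan is an EXACT
  split of the crux — neither piece can die alone without the crux (both are consequences of it), and
  together they are the crux.

`LevelDescent` is written out verbatim (no new definition): it is the registered signature of
`stub_levelDescent` in the tree's vocabulary (`PseudoBounded`, `boolVariance`, `influence`, `evalBool`,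
`boolAvg` — definitionally the skeleton's `PseudoBounded/cvar/infl/ev/avg`), literally the conclusion of
`Cruxes.PseudoBoundedAA.Birth.levelDescent_of_pseudoBoundedAA`.  Honest label: glue for the planner and the
census; no stub of the registered skeleton is closed, the two open pieces (27399 and level descent) are
research-class.

Sources: AaronsonAmbainis2014 Conj. 6; EscuderoGutierrez2023 (arXiv:2304.06713) Thm 1.6 / Question 4.5;
ODonnellZhao2016 (arXiv:1512.01603) Thm 2.13 (comparison-clause reductions).
-/

-- D-0017: single-conjunct summit ⇒ the duplicate `QuantumAdvantage.QuantumAdvantage` is mandated.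
set_option linter.dupNamespace false

noncomputable section

namespace Summit.QuantumAdvantage.QuantumAdvantage.Theorems.SosSandwich

open Finset MvPolynomial Literature.Computability.QuantumComplexity
open Summit.QuantumAdvantage.QuantumAdvantage.Theses.SosSandwich

namespace RepairedLine

/-- `Var[p] ≤ 1/4` for `p ∈ K_T`, hence `ε/T ≤ 1` whenever `ε ≤ Var[p]` and `T ≥ 1`. [folklore] -/
theorem eps_div_le_one {N T : ℕ} {p : MvPolynomial (Fin N) ℝ} {ε : ℝ} (hT : 1 ≤ T) (hp : PseudoBounded T p)
    (hv : ε ≤ boolVariance p) : ε / T ≤ 1 := by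
  have hTpos : (0 : ℝ) < T := by exact_mod_cast hT
  have hT1 : (1 : ℝ) ≤ T := by exact_mod_cast hT
  rw [div_le_one hTpos]
  have h4 := boolVariance_le_quarter hp
  linarith

/-- Monotonicity of powers of a number in `[0,1]`: `s^(m+n) ≤ s^m`. [folklore] -/
theorem pow_add_le_pow {s : ℝ} (h0 : 0 ≤ s) (h1 : s ≤ 1) (m n : ℕ) : s ^ (m + n) ≤ s ^ m := by
  rw [pow_add]
  exact mul_le_of_le_one_right (pow_nonneg h0 m) (pow_le_one₀ h0 h1)

end RepairedLine

open RepairedLine in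
/-- **The repaired composition: `HomogeneousPBAAT → LevelDescent → PseudoBoundedAA`.**  Granted the T-lossy
homogeneous rung (route support item `HomogeneousPBAAT`, stmt-QuantumAdvantage-27399, constants `(c, C)`) and
level descent with polynomial loss (the registered `stub_levelDescent` of the crux skeleton, constants
`(a, A, B)`, written out in the tree's vocabulary), PB-AA holds with exponent `2a + (a+1)c` and constant
`min(4A²/9, C·A^c)/B`: descend to a surrogate `q ∈ K_{T'}` (`1 ≤ T' ≤ T`) in a flat base class with
`Var[q] ≥ A(ε/T)^a` and dominated influences; if `T' = 1` the proved `OneQueryFrameAA` gives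
`Inf_i[q] ≥ (4/9)Var[q]²`; if `q` is top-homogeneous the rung gives `Inf_i[q] ≥ C(Var[q]/T')^c ≥ C(A(ε/T)^{a+1})^c`
(`1/T' ≥ 1/T ≥ ε/T` as `ε ≤ Var[p] ≤ 1/4`); pull back `Inf_{i'}[p] ≥ Inf_i[q]/B`.
[cite: EscuderoGutierrez2023, Question 4.5] [cite: AaronsonAmbainis2014, Conj. 6] -/
theorem pseudoBoundedAA_of_homogeneousPBAAT_of_levelDescent (hH : HomogeneousPBAAT)
    (hD : ∃ (a : ℕ) (A B : ℝ), 0 < A ∧ 0 < B ∧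
      ∀ (N T : ℕ) (p : MvPolynomial (Fin N) ℝ) (ε : ℝ), 1 ≤ T → PseudoBounded T p → 0 < ε →
        ε ≤ boolVariance p →
        ∃ (N' T' : ℕ) (q : MvPolynomial (Fin N') ℝ), 1 ≤ T' ∧ T' ≤ T ∧ PseudoBounded T' q ∧
          (T' = 1 ∨ (∀ x : Fin N' → Bool, ∑ i : Fin N', (evalBool q x - evalBool q (Function.update x i (!x i))) =
            4 * (T' : ℝ) * (evalBool q x - boolAvg (evalBool q)))) ∧
          A * (ε / T) ^ a ≤ boolVariance q ∧
          ∀ i : Fin N', ∃ i' : Fin N, influence i q ≤ B * influence i' p) :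
    PseudoBoundedAA := by
  obtain ⟨c, C, hC, hHb⟩ := hH
  obtain ⟨a, A, B, hA, hB, hDb⟩ := hD
  -- the two base theorems in tree vocabulary
  have h1 : ∀ (N : ℕ) (q : MvPolynomial (Fin N) ℝ), PseudoBounded 1 q → 0 < boolVariance q →
      ∃ i : Fin N, 4 * boolVariance q ^ 2 ≤ 9 * influence i q :=
    fun N q hq hv => OneQueryFrameAA_proof N q hq hv
  have hR : ∀ (N T : ℕ) (q : MvPolynomial (Fin N) ℝ), 1 ≤ T → PseudoBounded T q →
      (∀ x : Fin N → Bool, ∑ i : Fin N, (evalBool q x - evalBool q (Function.update x i (!x i))) =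
        4 * (T : ℝ) * (evalBool q x - boolAvg (evalBool q))) → 0 < boolVariance q →
      ∃ i : Fin N, C * (boolVariance q / (T : ℝ)) ^ c ≤ influence i q :=
    fun N T q hT hq hhom hv => hHb N T q hT hq hhom hv
  -- constants
  set K : ℝ := min (4 * A ^ 2 / 9) (C * A ^ c) / B with hK
  refine ⟨2 * a + (a + 1) * c, K, by positivity, fun N T p ε hT hp hε hv => ?_⟩
  -- the binders arrive in the route's inline spelling; name their tree-vocabulary forms (defeq)
  have hp' : PseudoBounded T p := hp
  have hv' : ε ≤ boolVariance p := hv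
  obtain ⟨N', T', q, hT'1, hT'T, hq, hbase, hvar, hdom⟩ := hDb N T p ε hT hp' hε hv'
  set s : ℝ := ε / T with hs
  have hTpos : (0 : ℝ) < T := by exact_mod_cast hT
  have hs0 : 0 < s := div_pos hε hTpos
  have hs1 : s ≤ 1 := eps_div_le_one hT hp' hv'
  have hAs : 0 < A * s ^ a := by positivity
  have hvq : 0 < boolVariance q := lt_of_lt_of_le hAs hvar
  -- an influential variable of the surrogate, with the common floor `min(4A²/9, C A^c) · s^(2a+(a+1)c)`
  have key : ∃ i : Fin N', min (4 * A ^ 2 / 9) (C * A ^ c) * s ^ (2 * a + (a + 1) * c) ≤ influence i q := by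
    rcases hbase with hT1 | hhom
    · subst hT1
      obtain ⟨i, hi⟩ := h1 N' q hq hvq
      refine ⟨i, ?_⟩
      have hsq : (A * s ^ a) ^ 2 ≤ boolVariance q ^ 2 := pow_le_pow_left₀ hAs.le hvar 2
      have hpow : s ^ (2 * a + (a + 1) * c) ≤ s ^ (2 * a) := pow_add_le_pow hs0.le hs1 _ _
      have hmin : min (4 * A ^ 2 / 9) (C * A ^ c) ≤ 4 * A ^ 2 / 9 := min_le_left _ _
      have hm0 : 0 ≤ min (4 * A ^ 2 / 9) (C * A ^ c) := le_min (by positivity) (by positivity)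
      calc min (4 * A ^ 2 / 9) (C * A ^ c) * s ^ (2 * a + (a + 1) * c)
          ≤ (4 * A ^ 2 / 9) * s ^ (2 * a) := mul_le_mul hmin hpow (by positivity) (by positivity)
        _ = 4 / 9 * (A * s ^ a) ^ 2 := by rw [pow_mul]; ring
        _ ≤ 4 / 9 * boolVariance q ^ 2 := by gcongr
        _ ≤ influence i q := by linarith
    · obtain ⟨i, hi⟩ := hR N' T' q hT'1 hq hhom hvq
      refine ⟨i, le_trans ?_ hi⟩
      have hT'pos : (0 : ℝ) < T' := by exact_mod_cast hT'1
      have hT'le : (T' : ℝ) ≤ T := by exact_mod_cast hT'T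
      -- `A s^(a+1) ≤ Var[q]/T'`
      have hsT : s ≤ 1 / (T' : ℝ) := by
        have hε1 : ε ≤ 1 := by
          have := boolVariance_le_quarter hp'
          linarith
        calc s = ε / T := hs
          _ ≤ 1 / T := by gcongr
          _ ≤ 1 / (T' : ℝ) := one_div_le_one_div_of_le hT'pos hT'le
      have hstep : A * s ^ (a + 1) ≤ boolVariance q / (T' : ℝ) := by
        calc A * s ^ (a + 1) = (A * s ^ a) * s := by ring
          _ ≤ boolVariance q * (1 / (T' : ℝ)) := mul_le_mul hvar hsT hs0.le hvq.le
          _ = boolVariance q / (T' : ℝ) := by ring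
      have hpowc : (A * s ^ (a + 1)) ^ c ≤ (boolVariance q / (T' : ℝ)) ^ c :=
        pow_le_pow_left₀ (by positivity) hstep c
      have hpow : s ^ (2 * a + (a + 1) * c) ≤ s ^ ((a + 1) * c) := by
        rw [add_comm (2 * a)]
        exact pow_add_le_pow hs0.le hs1 _ _
      have hmin : min (4 * A ^ 2 / 9) (C * A ^ c) ≤ C * A ^ c := min_le_right _ _
      calc min (4 * A ^ 2 / 9) (C * A ^ c) * s ^ (2 * a + (a + 1) * c)
          ≤ (C * A ^ c) * s ^ ((a + 1) * c) := mul_le_mul hmin hpow (by positivity) (by positivity)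
        _ = C * (A * s ^ (a + 1)) ^ c := by rw [mul_pow, ← pow_mul]; ring
        _ ≤ C * (boolVariance q / (T' : ℝ)) ^ c := by gcongr
  obtain ⟨i, hi⟩ := key
  obtain ⟨i', hi'⟩ := hdom i
  refine ⟨i', ?_⟩
  -- pull back through the domination clause
  have hchain : min (4 * A ^ 2 / 9) (C * A ^ c) * s ^ (2 * a + (a + 1) * c) ≤ B * influence i' p :=
    hi.trans hi'
  have hrew : K * s ^ (2 * a + (a + 1) * c) =
      (min (4 * A ^ 2 / 9) (C * A ^ c) * s ^ (2 * a + (a + 1) * c)) / B := by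
    rw [hK]; ring
  show K * s ^ (2 * a + (a + 1) * c) ≤ influence i' p
  rw [hrew, div_le_iff₀ hB]
  linarith [mul_comm B (influence i' p)]

/-- **The crux gives the repaired rung** (`PseudoBoundedAA → HomogeneousPBAAT`, same constants, `ε := Var[p]`;
homogeneity unused) — by-name wrapper of `homogeneousPBAAT_body_of_pseudoBoundedAA_body`.
[cite: EscuderoGutierrez2023, Cor. 1.7] -/
theorem homogeneousPBAAT_of_pseudoBoundedAA (h : PseudoBoundedAA) : HomogeneousPBAAT := by
  obtain ⟨c, C, hC, hb⟩ := h
  exact ⟨c, C, hC, homogeneousPBAAT_body_of_pseudoBoundedAA_body c C hb⟩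

/-- **The repaired two-layer plan is an exact split of the crux**:
`PseudoBoundedAA ↔ HomogeneousPBAAT ∧ LevelDescent` — (→) both pieces are consequences of PB-AA
(`homogeneousPBAAT_of_pseudoBoundedAA`; `Cruxes.PseudoBoundedAA.Birth.levelDescent_of_pseudoBoundedAA`: the
one-bit surrogate in `K_1`), (←) `pseudoBoundedAA_of_homogeneousPBAAT_of_levelDescent`.  So neither open piece
(27399, level descent) can be refuted alone without refuting the crux, unlike the dead degree-free rung.
[cite: AaronsonAmbainis2014, Conj. 6] [cite: EscuderoGutierrez2023, Question 4.5] -/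
theorem pseudoBoundedAA_iff_homogeneousPBAAT_and_levelDescent :
    PseudoBoundedAA ↔ HomogeneousPBAAT ∧
      ∃ (a : ℕ) (A B : ℝ), 0 < A ∧ 0 < B ∧
        ∀ (N T : ℕ) (p : MvPolynomial (Fin N) ℝ) (ε : ℝ), 1 ≤ T → PseudoBounded T p → 0 < ε →
          ε ≤ boolVariance p →
          ∃ (N' T' : ℕ) (q : MvPolynomial (Fin N') ℝ), 1 ≤ T' ∧ T' ≤ T ∧ PseudoBounded T' q ∧
            (T' = 1 ∨ (∀ x : Fin N' → Bool, ∑ i : Fin N', (evalBool q x - evalBool q (Function.update x i (!x i))) =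
              4 * (T' : ℝ) * (evalBool q x - boolAvg (evalBool q)))) ∧
            A * (ε / T) ^ a ≤ boolVariance q ∧
            ∀ i : Fin N', ∃ i' : Fin N, influence i q ≤ B * influence i' p :=
  ⟨fun h => ⟨homogeneousPBAAT_of_pseudoBoundedAA h,
      Cruxes.PseudoBoundedAA.Birth.levelDescent_of_pseudoBoundedAA h⟩,
    fun h => pseudoBoundedAA_of_homogeneousPBAAT_of_levelDescent h.1 h.2⟩

end Summit.QuantumAdvantage.QuantumAdvantage.Theorems.SosSandwich

end
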